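import Mathlib
import Literature.Analysis.FluidPDE.BiotSavartWeakLp
import Literature.Analysis.SingularIntegrals.HardyLittlewoodSobolev
import Literature.Analysis.FluidPDE.UlocKernelEstimates
import HarnessLib

/-!
# The VOLUME-SLAVING INEQUALITY for the Biot–Savart energy: `∫|K₃ ∗ ω|² ≤ C · vol(supp ω)^{2/3} · ∫|ω|²`
# (crux `EulerZoomLiouville.PowerGaugeEulerLiouville` = stmt-NavierStokesRegularity-19832; line `vortex-volume` of ns-idea-11, stub V2
# `stub_vortexVolumeEnergy` = `VortexVolumeEnergyIneq` — filler)

Route `EulerZoomLiouville` (NavierStokesRegularity); width seat ns-ezl-w1 on the interim LEAD ns-typeII-p2 g10's assignment (2026-08-28T05:45:47Z,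
chain V2 → V1 → V1b → V3).  Pure harmonic analysis on `ℝ³`:

  `‖(K₃ ∗ ω)(x)‖ ≤ (4π)⁻¹ I₁‖ω‖(x)` (tree `enorm_biotSavart_le_rieszPotential`),
  `‖I₁Φ‖₂ ≤ C_{HLS} ‖Φ‖_{6/5}` (tree `lintegral_rieszPotential_rpow_le'`, Stein's Hardy–Littlewood–Sobolev theorem with `n = 3`, `α = 1`,
  `p = 6/5`, `q = np/(n − αp) = 2`), and Hölder on the support `‖Φ‖_{6/5} ≤ vol(supp Φ)^{1/3} ‖Φ‖₂` (exponents `5/3`, `5/2`), give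

* `CompactVortex.vortexVolumeEnergyIneq` — `∃ C, ∀ ω` continuous with compact support,
  `∫ ‖K₃ ∗ ω‖² ≤ C · vol(supp ω)^{2/3} · ∫ ‖ω‖²` — verbatim the line's `VortexVolumeEnergyIneq` (the LEAD fills `stub_vortexVolumeEnergy` with it).

The physical content for the line: a velocity slaved to a vorticity of FIXED support volume `V₀` (vortex volume is a Lagrangian invariant of
classical Euler) has energy `≤ C V₀^{2/3} · enstrophy`, so the `E`-gauge starves the `A`-gauge (stub V3).  (Continuity is used only for
measurability; compact support is not used — the inequality holds for every measurable `ω`, with `vol(supp ω) = ∞` allowed.)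
WHAT THIS IS NOT: not NS, not E, not V3 — one M-sized stratum tool `--supports` stmt-19832. [cite: Stein1971, Ch. V §1.2 Theorem 1 (b)]
-/

noncomputable section

-- flat `Theorems/<Route><Decl>…` files of one crux share the namespace of the crux (tree convention: `Summit.<S>.<S>.…`)
set_option linter.dupNamespace false

open MeasureTheory Set Filter Topology Metric Function TopologicalSpace
open scoped ENNReal NNReal

namespace Summit.NavierStokesRegularity.NavierStokesRegularity.Theorems.PowerGaugeEulerLiouville

open Literature.Analysis Literature.Analysis.SingularIntegrals Literature.Analysis.FluidPDE

namespace CompactVortex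

/-- **Hölder on the support, exponents `(5/3, 5/2)`**: `∫ Φ^{6/5} ≤ (∫ Φ²)^{3/5} · vol(supp Φ)^{2/5}` for a measurable size
`Φ : ℝ³ → [0,∞]` (the integrand lives on `supp Φ`). [folklore] -/
theorem lintegral_rpow_sixFifths_le {Φ : EuclideanSpace ℝ (Fin 3) → ℝ≥0∞} (hΦ : Measurable Φ) :
    ∫⁻ y, Φ y ^ (6 / 5 : ℝ) ≤
      (∫⁻ y, Φ y ^ (2 : ℝ)) ^ (3 / 5 : ℝ) * volume (Function.support Φ) ^ (2 / 5 : ℝ) := by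
  set S : Set (EuclideanSpace ℝ (Fin 3)) := Function.support Φ with hS
  -- the integrand vanishes off the support
  have hsupp : Function.support (fun y => Φ y ^ (6 / 5 : ℝ)) ⊆ S := by
    intro y hy
    rw [Function.mem_support] at hy ⊢
    intro h0
    exact hy (by rw [h0, ENNReal.zero_rpow_of_pos (by norm_num)])
  have hle : ∫⁻ y, Φ y ^ (6 / 5 : ℝ) ≤ ∫⁻ y in S, Φ y ^ (6 / 5 : ℝ) := by
    calc ∫⁻ y, Φ y ^ (6 / 5 : ℝ) = ∫⁻ y, S.indicator (fun y => Φ y ^ (6 / 5 : ℝ)) y := by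
          rw [Set.indicator_eq_self.2 hsupp]
      _ ≤ ∫⁻ y in S, Φ y ^ (6 / 5 : ℝ) := lintegral_indicator_le _ _
  -- Hölder on `volume.restrict S`
  have hpq : (5 / 3 : ℝ).HolderConjugate (5 / 2) := by rw [Real.holderConjugate_iff]; norm_num
  have hH := ENNReal.lintegral_mul_le_Lp_mul_Lq (volume.restrict S) hpq
    (f := fun y => Φ y ^ (6 / 5 : ℝ)) (g := fun _ => (1 : ℝ≥0∞))
    (hΦ.pow_const _).aemeasurable aemeasurable_const
  simp only [Pi.mul_apply, mul_one, ENNReal.one_rpow, lintegral_const, Measure.restrict_apply_univ, one_mul] at hH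
  have hff : ∀ y, (Φ y ^ (6 / 5 : ℝ)) ^ (5 / 3 : ℝ) = Φ y ^ (2 : ℝ) := fun y => by
    rw [← ENNReal.rpow_mul]; norm_num
  simp_rw [hff] at hH
  refine hle.trans (hH.trans ?_)
  rw [show (1 / (5 / 3 : ℝ)) = 3 / 5 by norm_num, show (1 / (5 / 2 : ℝ)) = 2 / 5 by norm_num]
  exact mul_le_mul' (ENNReal.rpow_le_rpow (setLIntegral_le_lintegral _ _) (by norm_num)) le_rfl

/-- **THE VOLUME-SLAVING INEQUALITY** (`VortexVolumeEnergyIneq` of the line `vortex-volume`): there is a universal `C` such that for every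
continuous compactly supported vorticity `ω : ℝ³ → ℝ³`,
`∫ ‖(K₃ ∗ ω)(x)‖² dx ≤ C · vol(supp ω)^{2/3} · ∫ ‖ω‖²`
(`‖K₃ ∗ ω‖ ≤ (4π)⁻¹ I₁‖ω‖` pointwise, Hardy–Littlewood–Sobolev `‖I₁Φ‖₂ ≤ C_{HLS}‖Φ‖_{6/5}`, Hölder `‖Φ‖_{6/5} ≤ vol(supp Φ)^{1/3}‖Φ‖₂`;
`C = (4π)^{−2} C_{HLS}²`). [cite: Stein1971, Ch. V §1.2 Theorem 1 (b)] -/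
theorem vortexVolumeEnergyIneq :
    ∃ C : ℝ≥0, ∀ ω : EuclideanSpace ℝ (Fin 3) → EuclideanSpace ℝ (Fin 3), Continuous ω → HasCompactSupport ω →
      ∫⁻ x, ‖biotSavart ω x‖ₑ ^ 2 ≤
        (C : ℝ≥0∞) * volume (Function.support ω) ^ (2 / 3 : ℝ) * ∫⁻ x, ‖ω x‖ₑ ^ 2 := by
  -- the Hardy–Littlewood–Sobolev constant for `n = 3`, `α = 1`, `p = 6/5` (`q = 2`)
  obtain ⟨C, hC, hHLS⟩ := lintegral_rieszPotential_rpow_le' (μ := (volume : Measure (EuclideanSpace ℝ (Fin 3))))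
    (p := 6 / 5) (α := 1) (by norm_num) one_pos (by rw [finrank_real_euclideanSpace_fin_three]; norm_num)
  set c₀ : ℝ≥0∞ := ENNReal.ofReal (4 * Real.pi)⁻¹ with hc₀
  have hc₀t : c₀ ≠ ⊤ := ENNReal.ofReal_ne_top
  set K : ℝ≥0∞ := c₀ ^ 2 * C ^ (2 : ℝ) with hK
  have hKt : K ≠ ⊤ := ENNReal.mul_ne_top (ENNReal.pow_ne_top hc₀t) (ENNReal.rpow_ne_top_of_nonneg (by norm_num) hC.ne)
  refine ⟨K.toNNReal, fun ω hω _ => ?_⟩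
  rw [ENNReal.coe_toNNReal hKt]
  -- the size `Φ = ‖ω‖` and its Riesz potential
  set Φ : EuclideanSpace ℝ (Fin 3) → ℝ≥0∞ := fun y => (‖ω y‖ₑ : ℝ≥0∞) with hΦ
  have hΦm : Measurable Φ := hω.measurable.enorm
  set I : EuclideanSpace ℝ (Fin 3) → ℝ≥0∞ := rieszPotential volume 1 Φ with hI
  -- (1) pointwise domination
  have hpt : ∀ x, ‖biotSavart ω x‖ₑ ^ 2 ≤ c₀ ^ 2 * I x ^ (2 : ℝ) := by
    intro x
    have h := enorm_biotSavart_le_rieszPotential ω x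
    calc ‖biotSavart ω x‖ₑ ^ 2 ≤ (c₀ * I x) ^ 2 := pow_le_pow_left' h 2
      _ = c₀ ^ 2 * I x ^ (2 : ℝ) := by rw [mul_pow, ENNReal.rpow_two]
  -- (2) Hardy–Littlewood–Sobolev, squared: `∫ I² ≤ C² (∫ Φ^{6/5})^{5/3}`
  have hHLS' := hHLS Φ hΦm.aemeasurable
  rw [finrank_real_euclideanSpace_fin_three, show (3 : ℝ) * (6 / 5) / (3 - 1 * (6 / 5)) = 2 by norm_num] at hHLS'
  have h2 := ENNReal.rpow_le_rpow hHLS' (show (0 : ℝ) ≤ 2 by norm_num)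
  rw [← ENNReal.rpow_mul, show (1 / (2 : ℝ)) * 2 = 1 by norm_num, ENNReal.rpow_one,
    ENNReal.mul_rpow_of_nonneg _ _ (show (0 : ℝ) ≤ 2 by norm_num), ← ENNReal.rpow_mul,
    show (1 / (6 / 5 : ℝ)) * 2 = 5 / 3 by norm_num] at h2
  -- (3) Hölder on the support: `(∫ Φ^{6/5})^{5/3} ≤ (∫ Φ²) · vol(supp)^{2/3}`
  have h3 : (∫⁻ y, Φ y ^ (6 / 5 : ℝ)) ^ (5 / 3 : ℝ) ≤
      (∫⁻ y, Φ y ^ (2 : ℝ)) * volume (Function.support Φ) ^ (2 / 3 : ℝ) := by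
    have h := ENNReal.rpow_le_rpow (lintegral_rpow_sixFifths_le hΦm) (show (0 : ℝ) ≤ 5 / 3 by norm_num)
    rw [ENNReal.mul_rpow_of_nonneg _ _ (show (0 : ℝ) ≤ 5 / 3 by norm_num), ← ENNReal.rpow_mul, ← ENNReal.rpow_mul,
      show (3 / 5 : ℝ) * (5 / 3) = 1 by norm_num, show (2 / 5 : ℝ) * (5 / 3) = 2 / 3 by norm_num, ENNReal.rpow_one] at h
    exact h
  -- supports and squares in terms of `ω`
  have hsuppΦ : Function.support Φ = Function.support ω := by
    ext y; simp [hΦ]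
  have hsq : ∀ y, Φ y ^ (2 : ℝ) = ‖ω y‖ₑ ^ 2 := fun y => by rw [hΦ, ENNReal.rpow_two]
  simp_rw [hsuppΦ, hsq] at h3
  -- assemble
  calc ∫⁻ x, ‖biotSavart ω x‖ₑ ^ 2 ≤ ∫⁻ x, c₀ ^ 2 * I x ^ (2 : ℝ) := lintegral_mono hpt
    _ = c₀ ^ 2 * ∫⁻ x, I x ^ (2 : ℝ) := by
        rw [lintegral_const_mul' _ _ (ENNReal.pow_ne_top hc₀t)]
    _ ≤ c₀ ^ 2 * (C ^ (2 : ℝ) * (∫⁻ y, Φ y ^ (6 / 5 : ℝ)) ^ (5 / 3 : ℝ)) := by gcongr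
    _ ≤ c₀ ^ 2 * (C ^ (2 : ℝ) * ((∫⁻ y, ‖ω y‖ₑ ^ 2) * volume (Function.support ω) ^ (2 / 3 : ℝ))) := by gcongr
    _ = K * volume (Function.support ω) ^ (2 / 3 : ℝ) * ∫⁻ x, ‖ω x‖ₑ ^ 2 := by rw [hK]; ring

end CompactVortex

end Summit.NavierStokesRegularity.NavierStokesRegularity.Theorems.PowerGaugeEulerLiouville
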